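import Summits.AtomisticToContinuum.FouriersLaw.Theorems.BondHeatUncertaintySubdiffusiveBondHeatKernelGibbsE
import Mathlib.Topology.UniformSpace.UniformApproximation

/-!
# Kernel-level Gibbs invariance for the pinned chain, part F: continuity of the boundary kernel `K_N`

Clause (b) of `BoundaryEscapeDeficit.BoundaryKernelBasics` (stmt-AtomisticToContinuum-12239): `u ↦ K_N(u)` is
continuous on `ℝ`. Proof: the `L²(μ_T)`-contraction `∫ (P_u f)² dμ_T ≤ ∫ f² dμ_T` (Jensen for the Markov kernel +
kernel Gibbs invariance, part D) for continuous `f = O(e^{ϑH})`; the autocorrelations of the bounded truncations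
`θ₀^M = max(-M, min(M, p₀² - T))` are continuous (dominated convergence along the continuous flow); and they converge
to `K_N` UNIFORMLY in `u` because `∫ (θ₀ - θ₀^M)² dμ_T → 0` (weighted AM–GM). A uniform limit of continuous functions
is continuous.
-/

noncomputable section

open MeasureTheory ProbabilityTheory Filter Topology Set
open scoped NNReal ENNReal

namespace Summit.AtomisticToContinuum.FouriersLaw.Theorems.SubdiffusiveBondHeat

open Literature.MathematicalPhysics.KineticTheory.HeatConduction
open Literature.MathematicalPhysics.KineticTheory Literature.Probability.Process OscillatorChain

variable {N : ℕ}

/-! ### Continuity of `K_N` (BoundaryKernelBasics (b)) -/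

section Continuity

variable {ω₂ lam β γ : ℝ} (hω : 0 < ω₂) (hl : 0 ≤ lam) (hβ : 0 < β) (hγ : 0 < γ) {N : ℕ} (hN : 0 < N)
  {T : ℝ} (hT : 0 < T)
include hω hl hβ hγ hN hT

/-- **`L²(μ_T)`-contraction of the transition kernels** for continuous `f` dominated by `C e^{ϑH}`
(`0 < ϑ`, `2ϑ < 1/T`): `P_u f` is strongly measurable, `(P_u f)² ∈ L¹(μ_T)` and
`∫ (P_u f)² dμ_T ≤ ∫ f² dμ_T` (Jensen for the Markov kernel and invariance). [folklore] -/
theorem pinnedChain_integral_sq_act_le {ϑ C : ℝ} (hϑ0 : 0 < ϑ) (h2ϑ : 2 * ϑ < 1 / T) {f : PhaseSpace N → ℝ}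
    (hf : Continuous f) (hfb : ∀ y, |f y| ≤ C * Real.exp (ϑ * (pinnedChain ω₂ lam β γ).hamiltonian N y))
    (u : ℝ≥0) :
    Integrable (fun y => f y ^ 2) ((pinnedChain ω₂ lam β γ).gibbsMeasure N T) ∧
    Integrable (fun z => (∫ y, f y ∂((pinnedChain ω₂ lam β γ).transitionKernel N T T u z)) ^ 2)
      ((pinnedChain ω₂ lam β γ).gibbsMeasure N T) ∧
    ∫ z, (∫ y, f y ∂((pinnedChain ω₂ lam β γ).transitionKernel N T T u z)) ^ 2
        ∂((pinnedChain ω₂ lam β γ).gibbsMeasure N T) ≤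
      ∫ z, f z ^ 2 ∂((pinnedChain ω₂ lam β γ).gibbsMeasure N T) := by
  set P := pinnedChain ω₂ lam β γ with hP
  set μ := P.gibbsMeasure N T with hμ
  set κ := P.transitionKernel N T T u with hκ
  haveI : IsProbabilityMeasure μ := pinnedChain_isProbabilityMeasure_gibbsMeasure hω hl hβ.le γ N hT
  haveI : IsMarkovKernel κ := pinnedChain_isMarkovKernel_transitionKernel hω hl hβ.le hγ.le N T T u
  have hϑ1 : ϑ < 1 / T := by linarith
  have h2ϑ0 : 0 < 2 * ϑ := by positivity
  have hf2b : ∀ y, |f y ^ 2| ≤ C ^ 2 * Real.exp (2 * ϑ * P.hamiltonian N y) := fun y => by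
    rw [abs_pow, show C ^ 2 * Real.exp (2 * ϑ * P.hamiltonian N y) =
      (C * Real.exp (ϑ * P.hamiltonian N y)) ^ 2 by rw [mul_pow, ← Real.exp_nat_mul]; ring_nf]
    exact pow_le_pow_left₀ (abs_nonneg _) (hfb y) 2
  have hfκ : ∀ z, Integrable f (κ z) := fun z => integrable_of_abs_le_exp
    (pinnedChain_integrable_exp_mul_hamiltonian_transitionKernel hω hl hT hβ.le hγ.le hN hϑ0 hϑ1 u z) hf hfb
  have hf2κ : ∀ z, Integrable (fun y => f y ^ 2) (κ z) := fun z => integrable_of_abs_le_exp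
    (pinnedChain_integrable_exp_mul_hamiltonian_transitionKernel hω hl hT hβ.le hγ.le hN h2ϑ0 h2ϑ u z)
    (hf.pow 2) hf2b
  have hf2μ : Integrable (fun y => f y ^ 2) μ := integrable_of_abs_le_exp
    (pinnedChain_integrable_exp_mul_hamiltonian_gibbsMeasure hω hl hβ.le γ N hT h2ϑ) (hf.pow 2) hf2b
  set g : PhaseSpace N → ℝ := fun z => ∫ y, f y ∂(κ z) with hg
  have hgm : StronglyMeasurable g := hf.stronglyMeasurable.integral_kernel (κ := κ)
  have hjensen : ∀ z, g z ^ 2 ≤ ∫ y, f y ^ 2 ∂(κ z) := by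
    intro z
    have hvar : 0 ≤ ∫ y, (f y - g z) ^ 2 ∂(κ z) := integral_nonneg fun y => sq_nonneg _
    have hexp : ∫ y, (f y - g z) ^ 2 ∂(κ z) = (∫ y, f y ^ 2 ∂(κ z)) - g z ^ 2 := by
      have e : (fun y => (f y - g z) ^ 2) = fun y => f y ^ 2 - (2 * g z) * f y + g z ^ 2 := by
        funext y; ring
      have i1 : Integrable (fun y => f y ^ 2 - 2 * g z * f y) (κ z) := (hf2κ z).sub ((hfκ z).const_mul _)
      rw [e, integral_add i1 (integrable_const _), integral_sub (hf2κ z) ((hfκ z).const_mul _),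
        integral_const_mul, integral_const]
      simp only [probReal_univ, smul_eq_mul, one_mul]
      rw [show (∫ y, f y ∂(κ z)) = g z from rfl]
      ring
    linarith
  have hinv := pinnedChain_gibbsMeasure_bind_transitionKernel hω hl hβ.le hγ.le hN hT u
  have h' : (κ ∘ₖ Kernel.const Unit μ) () = μ := by rw [← Measure.comp_eq_comp_const_apply]; exact hinv
  have hf2' : Integrable (fun y => f y ^ 2) ((κ ∘ₖ Kernel.const Unit μ) ()) := by rw [h']; exact hf2μ
  have hP2int : Integrable (fun z => ∫ y, f y ^ 2 ∂(κ z)) μ := by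
    have := hf2'.integral_comp
    rwa [Kernel.const_apply] at this
  have hP2val : ∫ z, (∫ y, f y ^ 2 ∂(κ z)) ∂μ = ∫ z, f z ^ 2 ∂μ :=
    pinnedChain_integral_transitionKernel_gibbsMeasure hω hl hβ.le hγ.le hN hT u hf2μ
  have hg2int : Integrable (fun z => g z ^ 2) μ :=
    hP2int.mono' (hgm.measurable.pow_const 2).aestronglyMeasurable (Eventually.of_forall fun z => by
      rw [Real.norm_eq_abs, abs_of_nonneg (sq_nonneg _)]; exact hjensen z)
  refine ⟨hf2μ, hg2int, ?_⟩
  rw [← hP2val]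
  exact integral_mono_of_nonneg (Eventually.of_forall fun z => sq_nonneg _) hP2int (Eventually.of_forall hjensen)

omit hN hT in
/-- For bounded continuous `g`, `u ↦ P_{u⁺} g(z)` is continuous (dominated convergence along the continuous flow).
[folklore] -/
theorem pinnedChain_continuous_integral_transitionKernel_time {g : PhaseSpace N → ℝ} (hg : Continuous g) {B : ℝ}
    (hB : ∀ y, ‖g y‖ ≤ B) (z : PhaseSpace N) :
    Continuous fun u : ℝ => ∫ y, g y ∂((pinnedChain ω₂ lam β γ).transitionKernel N T T u.toNNReal z) := by
  have hrep : (fun u : ℝ => ∫ y, g y ∂((pinnedChain ω₂ lam β γ).transitionKernel N T T u.toNNReal z)) =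
      fun u => ∫ w, g ((pinnedChain ω₂ lam β γ).solMap N T T (u.toNNReal : ℝ) z (pairPath w)) ∂wienerPair := by
    funext u
    exact pinnedChain_integral_transitionKernel hω hl hβ.le hγ.le N T T _ z hg.aestronglyMeasurable
  rw [hrep]
  have hflow_cont : ∀ w, Continuous fun u : ℝ =>
      (pinnedChain ω₂ lam β γ).solMap N T T (u.toNNReal : ℝ) z (pairPath w) :=
    fun w => (pinnedChain_continuous_solMap hω hl hβ.le hγ.le N T T z (pairPath w)).comp
      (continuous_subtype_val.comp continuous_real_toNNReal)
  have hflow_meas : ∀ u : ℝ, Measurable fun w =>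
      (pinnedChain ω₂ lam β γ).solMap N T T (u.toNNReal : ℝ) z (pairPath w) :=
    fun u => pinnedChain_measurable_solMap_pairPath_right hω hl hβ.le hγ.le N T T _ z
  exact continuous_of_dominated (fun u => (hg.measurable.comp (hflow_meas u)).aestronglyMeasurable)
    (fun u => Eventually.of_forall fun w => hB _) (integrable_const B)
    (Eventually.of_forall fun w => hg.comp (hflow_cont w))

omit hN in
/-- For bounded continuous `g`, the autocorrelation `u ↦ ∫ g · P_{u⁺} g dμ_T` is continuous. [folklore] -/
theorem pinnedChain_continuous_corr_bounded {g : PhaseSpace N → ℝ} (hg : Continuous g) {B : ℝ}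
    (hB : ∀ y, ‖g y‖ ≤ B) :
    Continuous fun u : ℝ => ∫ z, g z * (∫ y, g y ∂((pinnedChain ω₂ lam β γ).transitionKernel N T T u.toNNReal z))
      ∂((pinnedChain ω₂ lam β γ).gibbsMeasure N T) := by
  set P := pinnedChain ω₂ lam β γ with hP
  set μ := P.gibbsMeasure N T with hμ
  haveI : IsProbabilityMeasure μ := pinnedChain_isProbabilityMeasure_gibbsMeasure hω hl hβ.le γ N hT
  haveI : ∀ u, IsMarkovKernel (P.transitionKernel N T T u) := fun u =>
    pinnedChain_isMarkovKernel_transitionKernel hω hl hβ.le hγ.le N T T u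
  have hB0 : 0 ≤ B := (norm_nonneg _).trans (hB 0)
  have hin : ∀ u : ℝ, ∀ z, ‖∫ y, g y ∂(P.transitionKernel N T T u.toNNReal z)‖ ≤ B := fun u z => by
    have := norm_integral_le_of_norm_le_const (μ := P.transitionKernel N T T u.toNNReal z) (Eventually.of_forall hB)
    simpa [probReal_univ] using this
  refine continuous_of_dominated (bound := fun _ => B * B) (fun u => ?_) (fun u => Eventually.of_forall fun z => ?_)
    (integrable_const _) (Eventually.of_forall fun z => ?_)
  · exact (hg.aestronglyMeasurable.mul
      (hg.stronglyMeasurable.integral_kernel (κ := P.transitionKernel N T T u.toNNReal)).aestronglyMeasurable)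
  · rw [norm_mul]
    exact mul_le_mul (hB z) (hin u z) (norm_nonneg _) hB0
  · exact continuous_const.mul (pinnedChain_continuous_integral_transitionKernel_time hω hl hβ hγ hg hB z)

omit hω hl hβ hγ hN hT in
/-- Weighted AM–GM under the integral: `|∫ a b dμ| ≤ (ε ∫ a² + ε⁻¹ ∫ b²)/2` for `ε > 0`, `a², b² ∈ L¹`. [folklore] -/
theorem abs_integral_mul_le_weighted {μ : Measure (PhaseSpace N)} {a b : PhaseSpace N → ℝ}
    (ha : Integrable (fun z => a z ^ 2) μ) (hb : Integrable (fun z => b z ^ 2) μ) {ε : ℝ} (hε : 0 < ε) :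
    |∫ z, a z * b z ∂μ| ≤ (ε * ∫ z, a z ^ 2 ∂μ + ε⁻¹ * ∫ z, b z ^ 2 ∂μ) / 2 := by
  have hbound : ∀ z, ‖a z * b z‖ ≤ (ε * a z ^ 2 + ε⁻¹ * b z ^ 2) / 2 := fun z => by
    rw [Real.norm_eq_abs, abs_mul]
    have h := sq_nonneg (ε * |a z| - |b z|)
    have h2 : (ε * |a z| - |b z|) ^ 2 = ε * (ε * |a z| ^ 2) + |b z| ^ 2 - |a z| * |b z| * (2 * ε) := by ring
    rw [h2, sq_abs, sq_abs] at h
    rw [show (ε * a z ^ 2 + ε⁻¹ * b z ^ 2) / 2 = (ε * (ε * a z ^ 2) + b z ^ 2) / (2 * ε) by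
      field_simp, le_div_iff₀ (by positivity)]
    linarith
  have hI : Integrable (fun z => ε * a z ^ 2 + ε⁻¹ * b z ^ 2) μ := (ha.const_mul ε).add (hb.const_mul ε⁻¹)
  have := norm_integral_le_of_norm_le (hI.div_const 2) (Eventually.of_forall hbound)
  rw [Real.norm_eq_abs, integral_div, integral_add (ha.const_mul ε) (hb.const_mul ε⁻¹), integral_const_mul,
    integral_const_mul] at this
  exact this

/-- **Continuity of the boundary kernel** `u ↦ K_N(u) = ∫ θ₀ · P_{u⁺}θ₀ dμ_T` (BoundaryKernelBasics (b)): `K_N` is the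
uniform limit of the continuous autocorrelations of the bounded truncations `θ₀^M = max(-M, min(M, θ₀))`, the error
being controlled by the `L²(μ_T)`-contraction of `P_u` and `∫ (θ₀ - θ₀^M)² dμ_T → 0`. [folklore] -/
theorem pinnedChain_continuous_kinCorr :
    Continuous fun u : ℝ => ∫ z, ((z.2 ⟨0, hN⟩) ^ 2 - T) *
        (∫ y, ((y.2 ⟨0, hN⟩) ^ 2 - T) ∂((pinnedChain ω₂ lam β γ).transitionKernel N T T u.toNNReal z))
      ∂((pinnedChain ω₂ lam β γ).gibbsMeasure N T) := by
  set P := pinnedChain ω₂ lam β γ with hP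
  set μ := P.gibbsMeasure N T with hμ
  set κ : ℝ → Kernel (PhaseSpace N) (PhaseSpace N) := fun u => P.transitionKernel N T T u.toNNReal with hκ
  haveI : IsProbabilityMeasure μ := pinnedChain_isProbabilityMeasure_gibbsMeasure hω hl hβ.le γ N hT
  set θ₀ : PhaseSpace N → ℝ := fun z => (z.2 ⟨0, hN⟩) ^ 2 - T with hθ₀
  have hθc : Continuous θ₀ := by fun_prop
  set ϑ : ℝ := 1 / (4 * T) with hϑ
  have hϑ0 : 0 < ϑ := by positivity
  have h2ϑ : 2 * ϑ < 1 / T := by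
    rw [hϑ, show 2 * (1 / (4 * T)) = 1 / (2 * T) by field_simp; ring, div_lt_div_iff₀ (by positivity) hT]
    nlinarith
  set M₀ : ℝ := 2 / ϑ + T with hM₀
  have hθM : ∀ y, |θ₀ y| ≤ M₀ * Real.exp (ϑ * P.hamiltonian N y) := fun y =>
    abs_sq_momentum_sub_le_exp hω hl hβ.le hϑ0 hT.le y ⟨0, hN⟩
  -- truncations
  set θM : ℕ → PhaseSpace N → ℝ := fun M z => max (-(M:ℝ)) (min (M:ℝ) (θ₀ z)) with hθM'
  have hθMc : ∀ M, Continuous (θM M) := fun M => continuous_const.max (continuous_const.min hθc)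
  have hθMb : ∀ M y, ‖θM M y‖ ≤ M := fun M y => by
    rw [Real.norm_eq_abs, abs_le]
    refine ⟨le_max_left _ _, max_le (by linarith [(M.cast_nonneg : (0:ℝ) ≤ M)]) (min_le_left _ _)⟩
  have hθMle : ∀ M y, |θM M y| ≤ |θ₀ y| := fun M y => by
    simp only [hθM']
    rcases le_total 0 (θ₀ y) with h | h
    · rw [abs_of_nonneg h, abs_of_nonneg (le_max_of_le_right (le_min (M.cast_nonneg) h))]
      exact max_le (by linarith [(M.cast_nonneg : (0:ℝ) ≤ M)]) (min_le_right _ _)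
    · have : min (M:ℝ) (θ₀ y) = θ₀ y := min_eq_right (h.trans M.cast_nonneg)
      rw [this, abs_of_nonpos h]
      rcases le_total (-(M:ℝ)) (θ₀ y) with h' | h'
      · rw [max_eq_right h', abs_of_nonpos h]
      · rw [max_eq_left h', abs_neg, abs_of_nonneg (M.cast_nonneg)]; linarith
  have hdiffle : ∀ M y, |θ₀ y - θM M y| ≤ |θ₀ y| := fun M y => by
    simp only [hθM']
    rcases le_total 0 (θ₀ y) with h | h
    · have hmax : max (-(M:ℝ)) (min (M:ℝ) (θ₀ y)) = min (M:ℝ) (θ₀ y) :=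
        max_eq_right (le_min (by linarith [(M.cast_nonneg : (0:ℝ) ≤ M)]) (by linarith [(M.cast_nonneg : (0:ℝ) ≤ M)]))
      rw [hmax, abs_of_nonneg h]
      rcases le_total (M:ℝ) (θ₀ y) with h' | h'
      · rw [min_eq_left h', abs_of_nonneg (by linarith)]; linarith [(M.cast_nonneg : (0:ℝ) ≤ M)]
      · rw [min_eq_right h', sub_self, abs_zero]; exact h
    · have : min (M:ℝ) (θ₀ y) = θ₀ y := min_eq_right (h.trans M.cast_nonneg)
      rw [this, abs_of_nonpos h]
      rcases le_total (-(M:ℝ)) (θ₀ y) with h' | h'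
      · rw [max_eq_right h', sub_self, abs_zero]; linarith
      · rw [max_eq_left h', abs_of_nonpos (by linarith)]; linarith [(M.cast_nonneg : (0:ℝ) ≤ M)]
  have hθMexp : ∀ M y, |θM M y| ≤ M₀ * Real.exp (ϑ * P.hamiltonian N y) := fun M y => (hθMle M y).trans (hθM y)
  have hdexp : ∀ M y, |θ₀ y - θM M y| ≤ M₀ * Real.exp (ϑ * P.hamiltonian N y) := fun M y =>
    (hdiffle M y).trans (hθM y)
  -- L² facts
  have hA := pinnedChain_integral_sq_act_le hω hl hβ hγ hN hT hϑ0 h2ϑ hθc hθM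
  set A : ℝ := ∫ z, θ₀ z ^ 2 ∂μ with hAdef
  have hA0 : 0 ≤ A := integral_nonneg fun z => sq_nonneg _
  set δ : ℕ → ℝ := fun M => ∫ z, (θ₀ z - θM M z) ^ 2 ∂μ with hδ
  have hδlim : Tendsto δ atTop (𝓝 0) := by
    have h0 : (0:ℝ) = ∫ z, (0:ℝ) ∂μ := by simp
    rw [h0]
    refine tendsto_integral_of_dominated_convergence (fun z => θ₀ z ^ 2)
      (fun M => (((hθc.sub (hθMc M)).pow 2)).aestronglyMeasurable) (hA 0).1
      (fun M => Eventually.of_forall fun z => ?_) (Eventually.of_forall fun z => ?_)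
    · rw [Real.norm_eq_abs, abs_pow, ← sq_abs (θ₀ z)]
      exact pow_le_pow_left₀ (abs_nonneg _) (hdiffle M z) 2
    · refine tendsto_const_nhds.congr' ?_
      obtain ⟨M₁, hM₁⟩ := exists_nat_ge |θ₀ z|
      filter_upwards [eventually_ge_atTop M₁] with M hM
      have hMr : |θ₀ z| ≤ M := hM₁.trans (by exact_mod_cast hM)
      have : θM M z = θ₀ z := by
        simp only [hθM']
        rw [min_eq_right (abs_le.1 hMr).2, max_eq_right (abs_le.1 hMr).1]
      simp [this]
  -- the continuous approximants
  set K : ℝ → ℝ := fun u => ∫ z, θ₀ z * (∫ y, θ₀ y ∂(κ u z)) ∂μ with hK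
  set KM : ℕ → ℝ → ℝ := fun M u => ∫ z, θM M z * (∫ y, θM M y ∂(κ u z)) ∂μ with hKM
  have hKMc : ∀ M, Continuous (KM M) := fun M =>
    pinnedChain_continuous_corr_bounded hω hl hβ hγ hT (hθMc M) (hθMb M)
  -- uniform approximation
  have hunif : TendstoUniformly KM K atTop := by
    rw [Metric.tendstoUniformly_iff]
    intro η hη
    set ε : ℝ := η / (2 * A + 2) with hε
    have hε0 : 0 < ε := by positivity
    have hδev : ∀ᶠ M in atTop, δ M < ε * (η / 2) :=
      (tendsto_order.1 hδlim).2 _ (by positivity)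
    filter_upwards [hδev] with M hM u
    rw [Real.dist_eq]
    -- split `K - KM = ∫ (θ₀ - θM) P θ₀ + ∫ θM P(θ₀ - θM)`
    set uu : ℝ≥0 := u.toNNReal
    have hB1 := pinnedChain_integral_sq_act_le hω hl hβ hγ hN hT hϑ0 h2ϑ hθc hθM uu
    have hB2 := pinnedChain_integral_sq_act_le hω hl hβ hγ hN hT hϑ0 h2ϑ (f := fun y => θ₀ y - θM M y)
      (hθc.sub (hθMc M)) (hdexp M) uu
    have hB3 := pinnedChain_integral_sq_act_le hω hl hβ hγ hN hT hϑ0 h2ϑ (hθMc M) (hθMexp M) uu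
    haveI : IsMarkovKernel (κ u) := pinnedChain_isMarkovKernel_transitionKernel hω hl hβ.le hγ.le N T T uu
    have hϑ1 : ϑ < 1 / T := by linarith
    have hθκ : ∀ z, Integrable θ₀ (κ u z) := fun z => integrable_of_abs_le_exp
      (pinnedChain_integrable_exp_mul_hamiltonian_transitionKernel hω hl hT hβ.le hγ.le hN hϑ0 hϑ1 uu z) hθc hθM
    have hθMκ : ∀ z, Integrable (θM M) (κ u z) := fun z => integrable_of_abs_le_exp
      (pinnedChain_integrable_exp_mul_hamiltonian_transitionKernel hω hl hT hβ.le hγ.le hN hϑ0 hϑ1 uu z)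
      (hθMc M) (hθMexp M)
    have hsplit : ∀ z, θ₀ z * (∫ y, θ₀ y ∂(κ u z)) - θM M z * (∫ y, θM M y ∂(κ u z)) =
        (θ₀ z - θM M z) * (∫ y, θ₀ y ∂(κ u z)) + θM M z * (∫ y, (θ₀ y - θM M y) ∂(κ u z)) := by
      intro z
      rw [integral_sub (hθκ z) (hθMκ z)]
      ring
    -- integrability of the two products (AM–GM domination)
    have hprod_int : ∀ {a b : PhaseSpace N → ℝ}, AEStronglyMeasurable a μ → AEStronglyMeasurable b μ →
        Integrable (fun z => a z ^ 2) μ → Integrable (fun z => b z ^ 2) μ → Integrable (fun z => a z * b z) μ := by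
      intro a b ham hbm ha hb
      have hI : Integrable (fun z => (a z ^ 2 + b z ^ 2) / 2) μ := (ha.add hb).div_const 2
      refine hI.mono' (ham.mul hbm) (Eventually.of_forall fun z => ?_)
      show ‖a z * b z‖ ≤ (a z ^ 2 + b z ^ 2) / 2
      rw [Real.norm_eq_abs, abs_mul]
      nlinarith [sq_nonneg (|a z| - |b z|), sq_abs (a z), sq_abs (b z)]
    have hm1 : AEStronglyMeasurable (fun z => ∫ y, θ₀ y ∂(κ u z)) μ :=
      (hθc.stronglyMeasurable.integral_kernel (κ := κ u)).aestronglyMeasurable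
    have hm2 : AEStronglyMeasurable (fun z => ∫ y, (θ₀ y - θM M y) ∂(κ u z)) μ :=
      ((hθc.sub (hθMc M)).stronglyMeasurable.integral_kernel (κ := κ u)).aestronglyMeasurable
    have hI1 : Integrable (fun z => (θ₀ z - θM M z) * ∫ y, θ₀ y ∂(κ u z)) μ :=
      hprod_int (a := fun z => θ₀ z - θM M z) (hθc.sub (hθMc M)).aestronglyMeasurable hm1 hB2.1 hB1.2.1
    have hI2 : Integrable (fun z => θM M z * ∫ y, (θ₀ y - θM M y) ∂(κ u z)) μ :=
      hprod_int (hθMc M).aestronglyMeasurable hm2 hB3.1 hB2.2.1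
    have hI0 : Integrable (fun z => θ₀ z * ∫ y, θ₀ y ∂(κ u z)) μ :=
      hprod_int hθc.aestronglyMeasurable hm1 hB1.1 hB1.2.1
    have hIM : Integrable (fun z => θM M z * ∫ y, θM M y ∂(κ u z)) μ :=
      hprod_int (hθMc M).aestronglyMeasurable
        ((hθMc M).stronglyMeasurable.integral_kernel (κ := κ u)).aestronglyMeasurable hB3.1 hB3.2.1
    have hdiff : K u - KM M u = (∫ z, (θ₀ z - θM M z) * ∫ y, θ₀ y ∂(κ u z) ∂μ) +
        ∫ z, θM M z * ∫ y, (θ₀ y - θM M y) ∂(κ u z) ∂μ := by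
      simp only [hK, hKM]
      rw [← integral_sub hI0 hIM, ← integral_add hI1 hI2]
      exact integral_congr_ae (Eventually.of_forall hsplit)
    -- the two weighted AM–GM bounds
    have hT1 := abs_integral_mul_le_weighted hB2.1 hB1.2.1 (ε := ε⁻¹) (inv_pos.2 hε0)
    have hT2 := abs_integral_mul_le_weighted hB3.1 hB2.2.1 hε0
    rw [inv_inv] at hT1
    have hθM2le : ∫ z, θM M z ^ 2 ∂μ ≤ A :=
      integral_mono_of_nonneg (Eventually.of_forall fun z => sq_nonneg _) (hA 0).1
        (Eventually.of_forall fun z => by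
          have := hθMle M z
          show θM M z ^ 2 ≤ θ₀ z ^ 2
          rw [← sq_abs (θM M z), ← sq_abs (θ₀ z)]
          exact pow_le_pow_left₀ (abs_nonneg _) this 2)
    have hPθ : ∫ z, (∫ y, θ₀ y ∂(κ u z)) ^ 2 ∂μ ≤ A := hB1.2.2
    have hPd : ∫ z, (∫ y, (θ₀ y - θM M y) ∂(κ u z)) ^ 2 ∂μ ≤ δ M := hB2.2.2
    have hδ0 : 0 ≤ δ M := integral_nonneg fun z => sq_nonneg _
    rw [hdiff]
    calc |(∫ z, (θ₀ z - θM M z) * ∫ y, θ₀ y ∂(κ u z) ∂μ) + ∫ z, θM M z * ∫ y, (θ₀ y - θM M y) ∂(κ u z) ∂μ|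
        ≤ |∫ z, (θ₀ z - θM M z) * ∫ y, θ₀ y ∂(κ u z) ∂μ| + |∫ z, θM M z * ∫ y, (θ₀ y - θM M y) ∂(κ u z) ∂μ| :=
          abs_add_le _ _
      _ ≤ (ε⁻¹ * δ M + ε * A) / 2 + (ε * A + ε⁻¹ * δ M) / 2 := by
          refine add_le_add (hT1.trans ?_) (hT2.trans ?_)
          · gcongr
          · gcongr
      _ = ε * A + ε⁻¹ * δ M := by ring
      _ < ε * A + ε⁻¹ * (ε * (η / 2)) := by gcongr
      _ = ε * A + η / 2 := by rw [← mul_assoc, inv_mul_cancel₀ hε0.ne', one_mul]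
      _ ≤ η := by
          rw [hε]
          have : η / (2 * A + 2) * A ≤ η / 2 := by
            rw [div_mul_eq_mul_div, div_le_div_iff₀ (by positivity) (by positivity)]
            nlinarith
          linarith
  exact hunif.continuous (Frequently.of_forall hKMc)

end Continuity

end Summit.AtomisticToContinuum.FouriersLaw.Theorems.SubdiffusiveBondHeat

end
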